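import Summits.RiemannHypothesis.RiemannHypothesis.Theorems.Splittings.RobinFiniteC1Main
import HarnessLib

/-!
# RobinFiniteC1All — Part 6/6 — the ALL-`n` currency: `robin_le_PT2 : Buthe2016_thm2 → Buthe2018_thm2_theta →
BroadbentEtAl2021_theta_rel_1e19 → RiemannHypothesisUpTo 3000175332800 → ∀ n, 5040 < n → n ≤ 10 ^ 10 ^ 22 → robinInequality n`
(helpers `prime_rpow_le_of_dvd`, `dvd_of_rpow_lt`, `one_add_inv_lt_rpow`, `rpow_lt_one_add_inv`, `robin_all_of_robinCA_below`,
`log_le_of_le_ten_pow`).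

Robin 1984 §3 Prop. 1 (interpolation between consecutive colossally abundant numbers; tree theorem
`Robin1984_prop1_holds`) turns the CA-currency headline `RobinFiniteC1Main.robinCA_below_PT2` into a statement about ALL
integers.  The bridge from the prime bound to a size bound goes through the PARAMETER: for a maximiser `N` of
`σ(m)/m^{1+ε}` every prime `r ∣ N` has `r^ε ≤ 1 + 1/r`, and every prime `p` with `p^ε < 1 + 1/p` divides `N`
(Erdős–Nicolas 1975 Prop. 3 = tree `Nat.IsCAParameter.rpow_le_sigma_div` / `sigma_div_le_rpow`); parameters do not
increase along increasing maximisers (`Nat.IsCAParameter.antitone`).  With `ε⋆ = log(1 + 1/B⋆)/log B⋆`, `B⋆ = 2.5·10²²`,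
and `N⋆` a maximiser at `ε⋆` (`Nat.exists_greatest_isCAParameter`): every CA `M ≤ N⋆` has a parameter `≥ ε⋆`, hence all
its primes are `≤ B⋆`; and `N⋆` is divisible by every prime `≤ 2.4·10²²`, so `log N⋆ ≥ θ(2.4·10²²) ≥ 0.99947·2.4·10²² >
10²²·log 10` (`RobinFiniteE3.theta_ge_99947W`).  The power `10 ^ 10 ^ 22` is never evaluated (abstract bridge
`log_le_of_le_ten_pow`, cf. `RobinAnalytic.nat_le_ten_pow_of_log_le`).  Print benchmark in this currency: Morrill–Platt 2021,
`5041 ≤ n ≤ 10^(10^13.11485)` (direct CA computation).  No new hypothesis; modulo-list unchanged.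

Cell rh-split, seat rh-split-robin-finite g8 (brief sha16 f79c5f09d8bcb036), card `cards/SPLIT-robin-finite.md` §15;
carved from the kernel-checked object `HOME/rh-split-robin-finite/g8/SketchG8-I.lean` (rc 0, 0 warnings, 0 sorries,
axioms of `robin_le_PT2` = [propext, Classical.choice, Quot.sound]).  Zero `def`, zero `instance`, zero `notation`,
no attribute changes, no `native_decide`.

HONEST LABEL: SPLITTING SEARCH over kernel-typed RH-EQUIVALENCES; a splitting A ∧ B ⟹ RH is CONDITIONAL
bookkeeping unless A and B are both proved; nothing here bears on the truth of RH.
-/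

set_option linter.dupNamespace false

noncomputable section

open Real Filter Finset
open scoped Chebyshev

namespace Summit.RiemannHypothesis.RiemannHypothesis.Theorems.Splittings.RobinFiniteC1

open Literature.NumberTheory.LFunctions Literature.NumberTheory.DiophantineGeometry
open RobinAnalyticSharp
open Summit.RiemannHypothesis.RiemannHypothesis.Theorems.Splittings.RobinFiniteE3

section PartI

open scoped ArithmeticFunction.sigma in
/-- A prime dividing a maximiser of `F_ε` satisfies `r^ε ≤ 1 + 1/r` (Erdős–Nicolas 1975 Prop. 3 at the exponent
`v_r ≥ 1`, and `T(r, v) ≤ T(r, 0) = r + 1`). -/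
theorem prime_rpow_le_of_dvd {ε : ℝ} {N r : ℕ} (h : Nat.IsCAParameter ε N) (hN : N ≠ 0) (hr : r.Prime)
    (hrN : r ∣ N) : (r : ℝ) ^ ε ≤ 1 + 1 / r := by
  obtain ⟨m, rfl⟩ := hrN
  have hm : m ≠ 0 := by rintro rfl; simp at hN
  have h1 := h.rpow_le_sigma_div hm hr
  have h2 := Nat.sigma_prime_pow_succ_div_le_of_le hr (Nat.zero_le (m.factorization r))
  have h3 : (σ 1 (r ^ (0 + 1)) : ℝ) / σ 1 (r ^ 0) = r + 1 := by
    rw [Nat.sigma_prime_pow_succ_div hr 0]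
    simp
  have hr0 : (0 : ℝ) < r := by exact_mod_cast hr.pos
  have h4 : (r : ℝ) ^ (1 + ε) = r * (r : ℝ) ^ ε := by
    rw [Real.rpow_add hr0, Real.rpow_one]
  have h5 : (r : ℝ) * (r : ℝ) ^ ε ≤ r + 1 := by
    rw [← h4]; exact h1.trans (h2.trans_eq h3)
  rw [show (1 : ℝ) + 1 / r = (r + 1) / r by field_simp, le_div_iff₀ hr0]
  linarith

open scoped ArithmeticFunction.sigma in
/-- A prime with `p^ε < 1 + 1/p` divides every maximiser of `F_ε` (Erdős–Nicolas 1975 Prop. 3 at the exponent `0`: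
otherwise `T(p, 0) = p + 1 ≤ p^{1+ε}`). -/
theorem dvd_of_rpow_lt {ε : ℝ} {N p : ℕ} (h : Nat.IsCAParameter ε N) (hN : N ≠ 0) (hp : p.Prime)
    (hlt : (p : ℝ) ^ ε < 1 + 1 / p) : p ∣ N := by
  by_contra hnd
  have hv : N.factorization p = 0 := Nat.factorization_eq_zero_of_not_dvd hnd
  have h1 := h.sigma_div_le_rpow hN hp
  rw [hv, Nat.sigma_prime_pow_succ_div hp 0] at h1
  simp only [pow_zero] at h1
  have hp0 : (0 : ℝ) < p := by exact_mod_cast hp.pos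
  have h4 : (p : ℝ) ^ (1 + ε) = p * (p : ℝ) ^ ε := by
    rw [Real.rpow_add hp0, Real.rpow_one]
  have hσ : (σ 1 1 : ℝ) = 1 := by simp
  rw [hσ, h4] at h1
  have : (1 : ℝ) + 1 / p ≤ (p : ℝ) ^ ε := by
    rw [show (1 : ℝ) + 1 / p = (p + 1) / p by field_simp, div_le_iff₀ hp0]
    linarith
  linarith

/-- Above the threshold: `B⋆ < r ⟹ 1 + 1/r < r^{ε⋆}`, `ε⋆ = log(1 + 1/B⋆)/log B⋆` (the function
`x ↦ log(1 + 1/x)/log x` is strictly decreasing on `(1, ∞)`). -/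
theorem one_add_inv_lt_rpow {Bs r : ℝ} (hBs : 1 < Bs) (hr : Bs < r) :
    1 + 1 / r < r ^ (Real.log (1 + 1 / Bs) / Real.log Bs) := by
  set ε : ℝ := Real.log (1 + 1 / Bs) / Real.log Bs with hε_def
  have hB0 : 0 < Bs := by linarith
  have hr0 : 0 < r := by linarith
  have hlB : 0 < Real.log Bs := Real.log_pos hBs
  have hlr : Real.log Bs < Real.log r := Real.log_lt_log hB0 hr
  have hnum : 0 < Real.log (1 + 1 / Bs) := Real.log_pos (by
    have : 0 < 1 / Bs := by positivity
    linarith)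
  have hε : 0 < ε := div_pos hnum hlB
  have h1 : Real.log (1 + 1 / r) < Real.log (1 + 1 / Bs) := by
    apply Real.log_lt_log (by positivity)
    have : 1 / r < 1 / Bs := one_div_lt_one_div_of_lt hB0 hr
    linarith
  have h2 : Real.log (1 + 1 / Bs) = ε * Real.log Bs := by
    rw [hε_def, div_mul_cancel₀ _ hlB.ne']
  have h3 : ε * Real.log Bs < ε * Real.log r := mul_lt_mul_of_pos_left hlr hε
  have h4 : Real.log (1 + 1 / r) < ε * Real.log r := by linarith
  have h5 : 1 + 1 / r = Real.exp (Real.log (1 + 1 / r)) := (Real.exp_log (by positivity)).symm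
  rw [h5, Real.rpow_def_of_pos hr0, mul_comm (Real.log r)]
  exact Real.exp_lt_exp.2 h4

/-- Below the threshold: `1 < p < B⋆ ⟹ p^{ε⋆} < 1 + 1/p`. -/
theorem rpow_lt_one_add_inv {Bs p : ℝ} (hBs : 1 < Bs) (hp1 : 1 < p) (hp : p < Bs) :
    p ^ (Real.log (1 + 1 / Bs) / Real.log Bs) < 1 + 1 / p := by
  set ε : ℝ := Real.log (1 + 1 / Bs) / Real.log Bs with hε_def
  have hB0 : 0 < Bs := by linarith
  have hp0 : 0 < p := by linarith
  have hlB : 0 < Real.log Bs := Real.log_pos hBs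
  have hlp : 0 < Real.log p := Real.log_pos hp1
  have hlr : Real.log p < Real.log Bs := Real.log_lt_log hp0 hp
  have hnum : 0 < Real.log (1 + 1 / Bs) := Real.log_pos (by
    have : 0 < 1 / Bs := by positivity
    linarith)
  have hε : 0 < ε := div_pos hnum hlB
  have h1 : Real.log (1 + 1 / Bs) < Real.log (1 + 1 / p) := by
    apply Real.log_lt_log (by positivity)
    have : 1 / Bs < 1 / p := one_div_lt_one_div_of_lt hp0 hp
    linarith
  have h2 : Real.log (1 + 1 / Bs) = ε * Real.log Bs := by
    rw [hε_def, div_mul_cancel₀ _ hlB.ne']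
  have h3 : ε * Real.log p < ε * Real.log Bs := mul_lt_mul_of_pos_left hlr hε
  have h4 : ε * Real.log p < Real.log (1 + 1 / p) := by linarith
  have h5 : 1 + 1 / p = Real.exp (Real.log (1 + 1 / p)) := (Real.exp_log (by positivity)).symm
  rw [h5, Real.rpow_def_of_pos hp0, mul_comm (Real.log p)]
  exact Real.exp_lt_exp.2 h4

/-- **From the CA currency to all integers** (Robin 1984 §3 Prop. 1, `Robin1984_prop1_holds`): if Robin's inequality
holds at every colossally abundant `N > 5040` with all primes `< B`, if every prime `r` with `r^ε ≤ 1 + 1/r` is `< B`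
(`0 < ε`), and if `N⋆ > 5040` is a maximiser of `F_ε`, then Robin's inequality holds for every `5040 < n ≤ N⋆`. -/
theorem robin_all_of_robinCA_below {B : ℕ} (hRB : robinCA_below B) {ε : ℝ} (hε : 0 < ε)
    (hthr : ∀ r : ℕ, r.Prime → (r : ℝ) ^ ε ≤ 1 + 1 / r → r < B)
    {Ns : ℕ} (hNs : Nat.IsCAParameter ε Ns) (hNs1 : 5040 < Ns) :
    ∀ n : ℕ, 5040 < n → n ≤ Ns → robinInequality n := by
  classical
  -- Robin at every colossally abundant `M` with `5040 < M ≤ N⋆`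
  have hCAle : ∀ M : ℕ, M.ColossallyAbundant → 5040 < M → M ≤ Ns → robinInequality M := by
    intro M hM h5040 hMle
    have hM0 : M ≠ 0 := by omega
    obtain ⟨-, εM, hεM, hparM⟩ := hM
    have hε' : ∃ ε', ε ≤ ε' ∧ Nat.IsCAParameter ε' M := by
      rcases eq_or_lt_of_le hMle with h | h
      · subst h; exact ⟨ε, le_rfl, hNs⟩
      · exact ⟨εM, Nat.IsCAParameter.antitone hparM hNs (by omega) h, hparM⟩
    obtain ⟨ε', hεε', hpar'⟩ := hε'
    refine hRB M ⟨by omega, εM, hεM, hparM⟩ h5040 fun p hp hpM => hthr p hp ?_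
    have h1 : (p : ℝ) ^ ε' ≤ 1 + 1 / p := prime_rpow_le_of_dvd hpar' hM0 hp hpM
    have hp1 : (1 : ℝ) ≤ p := by exact_mod_cast hp.one_lt.le
    exact (Real.rpow_le_rpow_of_exponent_le hp1 hεε').trans h1
  -- interpolation between consecutive colossally abundant numbers, as in `Robin1984_thm1_of_parts`
  intro n hn hnle
  by_cases hsmall : n ≤ 55440
  · exact robinInequality_le_55440 n hn hsmall
  replace hsmall : 55440 < n := not_le.1 hsmall
  have hNsCA : Ns.ColossallyAbundant := ⟨by omega, ε, hε, hNs⟩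
  rcases eq_or_lt_of_le hnle with heq | hlt
  · rw [heq]; exact hCAle Ns hNsCA hNs1 le_rfl
  have hinf := Nat.setOf_colossallyAbundant_infinite_holds
  have hmono : StrictMono Nat.caSeq := Nat.caSeq_strictMono hinf
  obtain ⟨j, hj⟩ := Nat.exists_caSeq_eq Nat.colossallyAbundant_55440_holds
  obtain ⟨i, hi⟩ := Nat.exists_caSeq_eq hNsCA
  have hex : ∃ k, n < Nat.caSeq k := ⟨i, by rw [hi]; exact hlt⟩
  set k₁ := Nat.find hex with hk₁_def
  have hk₁ : n < Nat.caSeq k₁ := Nat.find_spec hex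
  have hk₁i : k₁ ≤ i := Nat.find_min' hex (by rw [hi]; exact hlt)
  have hjk₁ : j < k₁ := by
    by_contra hle
    have := hmono.monotone (not_lt.1 hle)
    omega
  obtain ⟨k, hk⟩ : ∃ k, k₁ = k + 1 := Nat.exists_eq_add_one_of_ne_zero (by omega)
  have hkn : Nat.caSeq k ≤ n := by
    have := Nat.find_min hex (show k < k₁ by omega)
    exact not_lt.1 this
  have hjk : j ≤ k := by omega
  have hNbig : 55440 ≤ Nat.caSeq k := hj ▸ hmono.monotone hjk
  have hN'big : Nat.caSeq k < Nat.caSeq (k + 1) := hmono (lt_add_one k)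
  have hk1le : Nat.caSeq (k + 1) ≤ Ns := by rw [← hk, ← hi]; exact hmono.monotone hk₁i
  rw [hk] at hk₁
  refine Robin1984_prop1_holds (Nat.caSeq k) (Nat.caSeq (k + 1)) (Nat.colossallyAbundant_caSeq hinf k)
    (Nat.colossallyAbundant_caSeq hinf (k + 1)) hN'big ?_
    (hCAle _ (Nat.colossallyAbundant_caSeq hinf k) (by omega) (by omega))
    (hCAle _ (Nat.colossallyAbundant_caSeq hinf (k + 1)) (by omega) hk1le) n hkn hk₁.le
  intro m hm₁ hm₂ hm
  obtain ⟨i', rfl⟩ := Nat.exists_caSeq_eq hm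
  have h1 : k < i' := hmono.lt_iff_lt.1 hm₁
  have h2 : i' < k + 1 := hmono.lt_iff_lt.1 hm₂
  omega

/-- `N ≤ 10^k ⟹ log N ≤ k log 10` for naturals (no evaluation of the power; converse of
`RobinAnalytic.nat_le_ten_pow_of_log_le`). -/
theorem log_le_of_le_ten_pow {N k : ℕ} (hN : 0 < N) (h : N ≤ 10 ^ k) : Real.log N ≤ k * Real.log 10 := by
  have hNR : (0 : ℝ) < N := by exact_mod_cast hN
  have h1 : (N : ℝ) ≤ (10 : ℝ) ^ k := by exact_mod_cast h
  calc Real.log N ≤ Real.log ((10 : ℝ) ^ k) := Real.log_le_log hNR h1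
    _ = k * Real.log 10 := by rw [Real.log_pow]

/-- **HEADLINE (gen 8, all integers): Robin's inequality `σ(n) < e^γ n log log n` for every `5040 < n ≤ 10^(10^22)`**,
modulo the SAME four print-only facts {Büthe 2016 Thm 2, Büthe 2018 Thm 2, BKLNW 2021, RH up to `3 000 175 332 800`
(Platt–Trudgian 2021)} — no conjecture in hypothesis position.  Print benchmark in the same currency: Morrill–Platt 2021
(`5041 ≤ n ≤ 10^(10^13.11485)`, by direct CA computation).  From `robinCA_below_PT2`, Robin's §3 Prop. 1
(`Robin1984_prop1_holds`) and the parameter bridge above (`B⋆ = 2.5·10²²`; `N⋆` a maximiser at `ε⋆`;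
`log N⋆ ≥ θ(2.4·10²²) ≥ 0.99947·2.4·10²² > 10²² log 10`).  Nothing here bears on the truth of RH. -/
theorem robin_le_PT2 (h16 : Buthe2016_thm2) (hB : Buthe2018_thm2_theta)
    (hK : BroadbentEtAl2021_theta_rel_1e19) (hRH : RiemannHypothesisUpTo 3000175332800) :
    ∀ n : ℕ, 5040 < n → n ≤ 10 ^ 10 ^ 22 → robinInequality n := by
  classical
  have hW := thetaWindow_PT h16 hRH
  have hRB := robinCA_below_PT2 h16 hB hK hRH
  set Bs : ℝ := 25 * 10 ^ 21 with hBs_def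
  set ε : ℝ := Real.log (1 + 1 / Bs) / Real.log Bs with hε_def
  have hBs1 : (1 : ℝ) < Bs := by rw [hBs_def]; norm_num
  have hε : 0 < ε := by
    refine div_pos (Real.log_pos ?_) (Real.log_pos hBs1)
    have : (0 : ℝ) < 1 / Bs := by positivity
    linarith
  obtain ⟨Ns, hNs1, hNs, -⟩ := Nat.exists_greatest_isCAParameter hε
  have hNs0 : Ns ≠ 0 := by omega
  -- threshold: primes with `r^ε ≤ 1 + 1/r` are `≤ B⋆ < 25·10²¹ + 1`
  have hthr : ∀ r : ℕ, r.Prime → (r : ℝ) ^ ε ≤ 1 + 1 / r → r < 25 * 10 ^ 21 + 1 := by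
    intro r hr hle
    by_contra hge
    push Not at hge
    have hr' : Bs < r := by
      rw [hBs_def]
      have : ((25 * 10 ^ 21 + 1 : ℕ) : ℝ) ≤ r := by exact_mod_cast hge
      push_cast at this; linarith
    have := one_add_inv_lt_rpow hBs1 hr'
    rw [← hε_def] at this
    linarith
  -- every prime `p ≤ 2.4·10²²` divides `N⋆`
  have hdiv : ∀ p ∈ Nat.primesLE (24 * 10 ^ 21), p ∣ Ns := by
    intro p hp
    obtain ⟨hple, hpp⟩ := Nat.mem_primesLE.1 hp
    refine dvd_of_rpow_lt hNs hNs0 hpp (rpow_lt_one_add_inv hBs1 (by exact_mod_cast hpp.one_lt) ?_)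
    have : (p : ℝ) ≤ 24 * 10 ^ 21 := by exact_mod_cast hple
    rw [hBs_def]; linarith
  have hprod : (∏ p ∈ Nat.primesLE (24 * 10 ^ 21), p) ∣ Ns :=
    Finset.prod_primes_dvd Ns (fun p hp => (Nat.mem_primesLE.1 hp).2.prime) hdiv
  -- hence `log N⋆ ≥ θ(2.4·10²²) ≥ 0.99947 · 2.4·10²²`
  have hlogNs : (2.398728e22 : ℝ) ≤ Real.log Ns := by
    have hle : (∏ p ∈ Nat.primesLE (24 * 10 ^ 21), p) ≤ Ns := Nat.le_of_dvd (by omega) hprod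
    have hpos : ∀ p ∈ Nat.primesLE (24 * 10 ^ 21), ((p : ℕ) : ℝ) ≠ 0 := fun p hp => by
      exact_mod_cast (Nat.mem_primesLE.1 hp).2.ne_zero
    have h1 : Real.log ((∏ p ∈ Nat.primesLE (24 * 10 ^ 21), p : ℕ) : ℝ) = θ ((24 * 10 ^ 21 : ℕ) : ℝ) := by
      rw [Chebyshev.theta_eq_sum_primesLE_log, Nat.cast_prod, Real.log_prod hpos]
    have hprodpos : (0 : ℝ) < ((∏ p ∈ Nat.primesLE (24 * 10 ^ 21), p : ℕ) : ℝ) := by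
      rw [Nat.cast_prod]; exact Finset.prod_pos fun p hp => by exact_mod_cast (Nat.mem_primesLE.1 hp).2.pos
    have h2 : Real.log ((∏ p ∈ Nat.primesLE (24 * 10 ^ 21), p : ℕ) : ℝ) ≤ Real.log Ns :=
      Real.log_le_log hprodpos (by exact_mod_cast hle)
    rw [h1] at h2
    have h3 : 0.99947 * ((24 * 10 ^ 21 : ℕ) : ℝ) ≤ θ ((24 * 10 ^ 21 : ℕ) : ℝ) :=
      theta_ge_99947W hW (by norm_num) (by norm_num)
    have h4 : (0.99947 : ℝ) * ((24 * 10 ^ 21 : ℕ) : ℝ) = 2.398728e22 := by norm_num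
    rw [h4] at h3
    exact h3.trans h2
  have hNs5040 : 5040 < Ns := by
    by_contra hle
    push Not at hle
    have h1 : (Ns : ℝ) ≤ 5040 := by exact_mod_cast hle
    have h2 : Real.log Ns ≤ Real.log 5040 := Real.log_le_log (by exact_mod_cast hNs1) h1
    have h3 : Real.log 5040 ≤ 5040 - 1 := Real.log_le_sub_one_of_pos (by norm_num)
    linarith
  intro n hn hle
  -- `n ≤ 10^(10^22) ⟹ log n ≤ 10²² log 10 < 0.99947·2.4·10²² ≤ log N⋆ ⟹ n ≤ N⋆`; the power is never evaluated
  -- (`hle` is consumed by the abstract bridge and cleared before any arithmetic tactic sees it).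
  have hn0 : 0 < n := lt_of_le_of_lt (Nat.zero_le 5040) hn
  have h1 : Real.log n ≤ ((10 ^ 22 : ℕ) : ℝ) * Real.log 10 := log_le_of_le_ten_pow hn0 hle
  clear hle
  refine robin_all_of_robinCA_below hRB hε hthr hNs hNs5040 n hn ?_
  by_contra hgt
  push Not at hgt
  have h10 := RobinAnalytic.log_ten_lt
  have h3 : Real.log Ns < Real.log n :=
    Real.log_lt_log (by exact_mod_cast hNs1) (by exact_mod_cast hgt)
  have h5 : ((10 ^ 22 : ℕ) : ℝ) = 1e22 := by norm_num
  rw [h5] at h1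
  have h4 : Real.log n ≤ 2.3025850935e22 := h1.trans (by nlinarith)
  exact absurd (hlogNs.trans (h3.le.trans h4)) (by norm_num)

end PartI

#print axioms robin_le_PT2

end Summit.RiemannHypothesis.RiemannHypothesis.Theorems.Splittings.RobinFiniteC1
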